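import Summits.Ventures.QEC.Thresholds.PlanarThresholdConverses
import Summits.Ventures.QEC.Thresholds.BBThresholdConverses
import Literature.InformationTheory.QuantumCodes.CSSMixedChannelConverse
import HarnessLib

/-!
# Loss–error phase diagram: the certified CEILING curve `p ≤ (1 − 2y)/(4(1 − y))` for the toric and planar codes
# (every erasure-aware decoder) and the `[[72,12,6]]` / `[[144,12,12]]` floors `1/4 ≤ P^mixed` on the curve

Venture QEC, `Summits/Ventures/QEC/Thresholds/` (LADDER-QEC rung Q5; qec-lit-2 gen 4). HONEST FRAMING. The
loss–error rows so far are FLOORS: `ToricCodeLossErrorTradeoff.lean` (certified correctable region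
`μ·Υ_CSS(y,p) < 1` for minimum-weight-outside decoders of the lattice toric code) and `BBLossErrorBounds.lean`
(finite size). `Literature/…/CSSMixedChannelConverse.lean` PROVES, for EVERY erasure-aware decoder, the mechanism of
the other side: `P_{y+2p(1−y)}[erasure uncorrectable] ≤ 2 · P^mixed_{y,p}[D]` (flips = erasures of rate `2p` + fair
coins; union of independent erasure patterns; involution count), hence for every CSS code with `k ≥ 1` and equal
sector erasure behaviour `1/4 ≤ P^mixed_{y,p}[D]` on the curve `y + 2p(1 − y) = 1/2`. Packaging:

* **toric codes** `toricHGPCode k` (`HGP(circ, circ)`, sectors exchanged by a re-indexing): at every loss rate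
  `0 ≤ y < 1/2`, every certified flip-threshold lower bound of the mixed family of EVERY erasure-aware decoder
  family is `≤ (1 − 2y)/(4(1 − y))` (`toricHGP_mixed_threshold_le`; `y = 0`: `1/4`; `y → 1/2`: `→ 0`), and the
  accuracy-threshold form; Stace–Barrett–Doherty's numerical boundary runs from `(0, .104)` to `(.5, 0)` INSIDE this
  region (VALIDATED column, not a theorem);
* **planar surface codes**: the same (`planar_mixed_threshold_le`);
* **`[[72,12,6]]`, `[[144,12,12]]`**: `1/4 ≤ P^mixed_{y,p}[D]` for every erasure-aware decoder at every point of the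
  curve (`bb72_quarter_le_mixedFailureProb`, `bb144_…`), complementing the finite-size ceilings ON failure of
  `BBLossErrorBounds.lean`.

Kernel axioms only; no named fact; no `native_decide`; no new definition.

## References

* [StaceBarrettDoherty2009] T. M. Stace, S. D. Barrett, A. C. Doherty, PRL 102 (2009) 200501, p. 2 and Fig. 2.
* [DumerKovalevPryadko2015] I. Dumer, A. A. Kovalev, L. P. Pryadko, PRL 115 (2015) 050502, Thm 2 (mixed channel).
* [RichardsonUrbanke2008] T. Richardson, R. Urbanke, *Modern Coding Theory*, Lemma 4.78 (Erasure Decomposition).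
* [BravyiEtAl2024] S. Bravyi et al., Nature 627 (2024) 778, Table 1.
-/

noncomputable section

namespace Summit.Ventures.QEC.Thresholds

open Filter Topology Finset Matrix
open Literature.InformationTheory.QuantumCodes

/-! ### Toric codes -/

section Toric

open Classical in
/-- **Toric loss–error ceiling curve, every decoder**: at loss rate `0 ≤ y < 1/2`, every certified flip-threshold
lower bound `a` of the mixed-channel family `(k, p) ↦ P^mixed_{y,p}[D_k]` (`Z`-sector, ANY erasure-aware decoders)
satisfies `a ≤ (1 − 2y)/(4(1 − y))`. [cite: StaceBarrettDoherty2009, p. 2 and Fig. 2 (boundary of the correctable region); RichardsonUrbanke2008, Lemma 4.78] -/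
theorem toricHGP_mixed_threshold_le
    (D : ∀ k, ErasureDecoder ((Fin (k + 2) × Fin (k + 2)) ⊕ (Fin (k + 2) × Fin (k + 2)))
      ((Fin (k + 2) × Fin (k + 2)) → ZMod 2))
    {y : ℝ} (hy0 : 0 ≤ y) (hy : y < 1 / 2) {a : ℝ}
    (ha : IsThresholdLowerBound (fun k p => mixedFailureProb (toricHGPCode k).HX
      ((toricHGPCode k).rowSpZ : Set (((Fin (k + 2) × Fin (k + 2)) ⊕ (Fin (k + 2) × Fin (k + 2))) → ZMod 2))
      (D k) y p) a) :
    a ≤ (1 - 2 * y) / (4 * (1 - y)) :=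
  mixed_threshold_le_of_symm (fun k => toricHGPCode k) toricHGPCode_k_pos (fun k y => toricHGP_xErasureFamily_eq k y)
    D hy0 hy ha

open Classical in
/-- Accuracy-threshold form: `p_c^{mixed}(y) ≤ (1 − 2y)/(4(1 − y))` for the toric codes, `0 ≤ y < 1/2`, every
erasure-aware decoder family. [cite: StaceBarrettDoherty2009, p. 2 and Fig. 2] -/
theorem toricHGP_mixed_accuracyThreshold_le
    (D : ∀ k, ErasureDecoder ((Fin (k + 2) × Fin (k + 2)) ⊕ (Fin (k + 2) × Fin (k + 2)))
      ((Fin (k + 2) × Fin (k + 2)) → ZMod 2))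
    {y : ℝ} (hy0 : 0 ≤ y) (hy : y < 1 / 2) :
    accuracyThreshold (fun k p => mixedFailureProb (toricHGPCode k).HX
      ((toricHGPCode k).rowSpZ : Set (((Fin (k + 2) × Fin (k + 2)) ⊕ (Fin (k + 2) × Fin (k + 2))) → ZMod 2))
      (D k) y p) ≤ (1 - 2 * y) / (4 * (1 - y)) :=
  toricHGP_mixed_threshold_le D hy0 hy (isThresholdLowerBound_accuracyThreshold _)

open Classical in
/-- **Finite size, on the curve**: every toric code `toricHGPCode k` and every erasure-aware decoder fail with
probability `≥ 1/4` at every `(y, p)` with `y + 2p(1 − y) = 1/2`. [cite: StaceBarrettDoherty2009, p. 2; RichardsonUrbanke2008, Lemma 4.78] -/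
theorem toricHGP_quarter_le_mixedFailureProb (k : ℕ)
    (D : ErasureDecoder ((Fin (k + 2) × Fin (k + 2)) ⊕ (Fin (k + 2) × Fin (k + 2))) ((Fin (k + 2) × Fin (k + 2)) → ZMod 2))
    {y p : ℝ} (hy0 : 0 ≤ y) (hy1 : y ≤ 1) (hp0 : 0 ≤ p) (hp : p ≤ 1 / 2) (hcurve : y + (1 - y) * (2 * p) = 1 / 2) :
    1 / 4 ≤ mixedFailureProb (toricHGPCode k).HX
      ((toricHGPCode k).rowSpZ : Set (((Fin (k + 2) × Fin (k + 2)) ⊕ (Fin (k + 2) × Fin (k + 2))) → ZMod 2)) D y p :=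
  (toricHGPCode k).quarter_le_mixedFailureProb_of_symm (toricHGPCode_k_pos k) (fun y => toricHGP_xErasureFamily_eq k y)
    D hy0 hy1 hp0 hp hcurve

end Toric

/-! ### Planar surface codes -/

section Planar

open Classical in
/-- **Planar loss–error ceiling curve, every decoder**: `a ≤ (1 − 2y)/(4(1 − y))` for every certified
flip-threshold lower bound of the mixed family at loss rate `0 ≤ y < 1/2` (first sector, ANY erasure-aware
decoders). [cite: StaceBarrettDoherty2009, p. 2 and Fig. 2; RichardsonUrbanke2008, Lemma 4.78] -/
theorem planar_mixed_threshold_le (D : ∀ k, ErasureDecoder (PlanarQubit k) (PlanarCheck k → ZMod 2))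
    {y : ℝ} (hy0 : 0 ≤ y) (hy : y < 1 / 2) {a : ℝ}
    (ha : IsThresholdLowerBound (fun k p => mixedFailureProb (planarHGPCode k).HX
      ((planarHGPCode k).rowSpZ : Set (PlanarQubit k → ZMod 2)) (D k) y p) a) :
    a ≤ (1 - 2 * y) / (4 * (1 - y)) :=
  mixed_threshold_le_of_symm (fun k => planarHGPCode k) planarHGPCode_k_pos (fun k y => planar_xErasureFamily_eq k y)
    D hy0 hy ha

open Classical in
/-- Accuracy-threshold form for the planar codes: `p_c^{mixed}(y) ≤ (1 − 2y)/(4(1 − y))`, `0 ≤ y < 1/2`.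
[cite: StaceBarrettDoherty2009, p. 2 and Fig. 2] -/
theorem planar_mixed_accuracyThreshold_le (D : ∀ k, ErasureDecoder (PlanarQubit k) (PlanarCheck k → ZMod 2))
    {y : ℝ} (hy0 : 0 ≤ y) (hy : y < 1 / 2) :
    accuracyThreshold (fun k p => mixedFailureProb (planarHGPCode k).HX
      ((planarHGPCode k).rowSpZ : Set (PlanarQubit k → ZMod 2)) (D k) y p) ≤ (1 - 2 * y) / (4 * (1 - y)) :=
  planar_mixed_threshold_le D hy0 hy (isThresholdLowerBound_accuracyThreshold _)

end Planar

/-! ### `[[72,12,6]]` and `[[144,12,12]]` on the curve -/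

section BB

open Classical in
/-- **`[[72,12,6]]`, losses `y` and flips `p` with `y + 2p(1−y) = 1/2`**: every erasure-aware decoder of the
`Z`-sector fails with probability `≥ 1/4`. [cite: StaceBarrettDoherty2009, p. 2; BravyiEtAl2024, Table 1 row [[72,12,6]]] -/
theorem bb72_quarter_le_mixedFailureProb (D : ErasureDecoder (BB.Mono 6 6 ⊕ BB.Mono 6 6) (BB.Mono 6 6 → ZMod 2))
    {y p : ℝ} (hy0 : 0 ≤ y) (hy1 : y ≤ 1) (hp0 : 0 ≤ p) (hp : p ≤ 1 / 2) (hcurve : y + (1 - y) * (2 * p) = 1 / 2) :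
    1 / 4 ≤ mixedFailureProb BB.bb72.HX (BB.bb72.css.rowSpZ : Set (BB.Mono 6 6 ⊕ BB.Mono 6 6 → ZMod 2)) D y p :=
  BB.bb72.css.quarter_le_mixedFailureProb_of_symm bb72_css_k_pos (fun y => bb72_xUncorrectableProb_eq y)
    D hy0 hy1 hp0 hp hcurve

open Classical in
/-- **`[[144,12,12]]`, on the curve `y + 2p(1−y) = 1/2`**: every erasure-aware decoder of the `Z`-sector fails
with probability `≥ 1/4`. [cite: StaceBarrettDoherty2009, p. 2; BravyiEtAl2024, Table 1 row [[144,12,12]]] -/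
theorem bb144_quarter_le_mixedFailureProb
    (D : ErasureDecoder (BB.Mono 12 6 ⊕ BB.Mono 12 6) (BB.Mono 12 6 → ZMod 2))
    {y p : ℝ} (hy0 : 0 ≤ y) (hy1 : y ≤ 1) (hp0 : 0 ≤ p) (hp : p ≤ 1 / 2) (hcurve : y + (1 - y) * (2 * p) = 1 / 2) :
    1 / 4 ≤ mixedFailureProb BB.bb144.HX (BB.bb144.css.rowSpZ : Set (BB.Mono 12 6 ⊕ BB.Mono 12 6 → ZMod 2)) D y p :=
  BB.bb144.css.quarter_le_mixedFailureProb_of_symm bb144_css_k_pos (fun y => bb144_xUncorrectableProb_eq y)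
    D hy0 hy1 hp0 hp hcurve

end BB

end Summit.Ventures.QEC.Thresholds
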